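import Literature.Analysis.FunctionSpaces.HolderInterpolation
import HarnessLib

/-!
# The class `C^{1,r}_b` in terms of `fderiv`

Topic `Literature/Analysis/FunctionSpaces`. The tree's `MemContDiffHolder k r f` /
`eContDiffHolderNorm k r f` (`HolderNorm.lean`; Gilbarg–Trudinger §4.1 (4.4)) are phrased with
Mathlib's iterated derivatives `iteratedFDeriv ℝ j f`. For `k = 1` — the velocity class
`C^{1,γ}` of the Euler theory (`FluidPDE.MemC1Holder`) — users produce and consume bounds on `f`
and on the Fréchet derivative `fderiv ℝ f`; this file is the dictionary (the first iterated
derivative is `fderiv` up to the linear isometry `continuousMultilinearCurryFin1`, cf.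
`MemContDiffHolder.toC1HolderMap` in `C1HolderMap.lean` and `memContDiffHolder_zero_iff`; the sup
bound `eSupNorm_le_ofReal` is the tree's, `HolderInterpolation.lean`):

* `iteratedFDeriv_one_eq_symm_comp_fderiv`, `eSupNorm_iteratedFDeriv_one`,
  `holderWith_iteratedFDeriv_one_iff`, `memHolder_iteratedFDeriv_one_iff`,
  `eHolderNorm_iteratedFDeriv_one`;
* `memContDiffHolder_one_iff : MemContDiffHolder 1 r f ↔ ContDiff ℝ 1 f ∧ eSupNorm f < ∞ ∧ MemBoundedHolder r (fderiv ℝ f)`;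
* `eContDiffHolderNorm_one_eq_fderiv : ‖f‖_{C^{1,r}} = ‖f‖_∞ + ‖Df‖_∞ + [Df]_r`;
* `memContDiffHolder_one_of_bounds`, `eContDiffHolderNorm_one_le_of_bounds` — membership and the
  norm bound `≤ M₀ + M₁ + C` from real bounds `|f| ≤ M₀`, `|Df| ≤ M₁`, `Df` `r`-Hölder with `C`.

## References

* D. Gilbarg, N. S. Trudinger, *Elliptic PDE of Second Order* (2001), §4.1, (4.4). [GilbargTrudinger2001]
-/

noncomputable section

open Filter Set
open scoped NNReal ENNReal

namespace Literature.Analysis.FunctionSpaces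

variable {E F : Type*} [NormedAddCommGroup E] [NormedSpace ℝ E] [NormedAddCommGroup F]
  [NormedSpace ℝ F] {r : ℝ≥0} {f : E → F}

/-- `D¹f = (curryFin1)⁻¹ ∘ Df`: the first iterated derivative is the Fréchet derivative read
through the linear isometry `continuousMultilinearCurryFin1`. [folklore] -/
theorem iteratedFDeriv_one_eq_symm_comp_fderiv (f : E → F) :
    iteratedFDeriv ℝ 1 f = fun x => (continuousMultilinearCurryFin1 ℝ E F).symm (fderiv ℝ f x) := by
  funext x
  have h : fderiv ℝ f x = (continuousMultilinearCurryFin1 ℝ E F) (iteratedFDeriv ℝ 1 f x) := by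
    ext v
    rw [continuousMultilinearCurryFin1_apply, iteratedFDeriv_one_apply]
    rfl
  rw [h, LinearIsometryEquiv.symm_apply_apply]

/-- `‖D¹f‖_∞ = ‖Df‖_∞`. [folklore] -/
theorem eSupNorm_iteratedFDeriv_one (f : E → F) :
    eSupNorm (iteratedFDeriv ℝ 1 f) = eSupNorm (fderiv ℝ f) := by
  simp only [eSupNorm, ← ofReal_norm, norm_iteratedFDeriv_one]

/-- `D¹f` is `r`-Hölder with constant `C` iff `Df` is. [folklore] -/
theorem holderWith_iteratedFDeriv_one_iff {C : ℝ≥0} :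
    HolderWith C r (iteratedFDeriv ℝ 1 f) ↔ HolderWith C r (fderiv ℝ f) := by
  simp only [HolderWith, iteratedFDeriv_one_eq_symm_comp_fderiv, LinearIsometryEquiv.edist_map]

/-- `D¹f` is `r`-Hölder iff `Df` is. [folklore] -/
theorem memHolder_iteratedFDeriv_one_iff :
    MemHolder r (iteratedFDeriv ℝ 1 f) ↔ MemHolder r (fderiv ℝ f) :=
  exists_congr fun _ => holderWith_iteratedFDeriv_one_iff

/-- `[D¹f]_r = [Df]_r`. [folklore] -/
theorem eHolderNorm_iteratedFDeriv_one (f : E → F) :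
    eHolderNorm r (iteratedFDeriv ℝ 1 f) = eHolderNorm r (fderiv ℝ f) := by
  simp only [eHolderNorm, holderWith_iteratedFDeriv_one_iff]

/-- **`C^{1,r}_b` in terms of `fderiv`**: `f ∈ C^{1,r}_b` iff `f` is `C¹`, bounded, and `Df` is
bounded and `r`-Hölder. [folklore] -/
theorem memContDiffHolder_one_iff :
    MemContDiffHolder 1 r f ↔ ContDiff ℝ 1 f ∧ eSupNorm f < ∞ ∧ MemBoundedHolder r (fderiv ℝ f) := by
  rw [MemContDiffHolder, memHolder_iteratedFDeriv_one_iff, MemBoundedHolder, eBoundedHolderNorm,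
    ENNReal.add_lt_top, eHolderNorm_lt_top]
  constructor
  · rintro ⟨hcd, hsup, hH⟩
    refine ⟨by exact_mod_cast hcd, (eSupNorm_iteratedFDeriv_zero f) ▸ hsup 0 zero_le_one, ?_, hH⟩
    rw [← eSupNorm_iteratedFDeriv_one]
    exact hsup 1 le_rfl
  · rintro ⟨hcd, hsup, hsup1, hH⟩
    refine ⟨by exact_mod_cast hcd, fun j hj => ?_, hH⟩
    rcases Nat.le_one_iff_eq_zero_or_eq_one.1 hj with rfl | rfl
    · rwa [eSupNorm_iteratedFDeriv_zero]
    · rwa [eSupNorm_iteratedFDeriv_one]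

/-- **The `C^{1,r}` norm in terms of `fderiv`**: `‖f‖_{C^{1,r}} = ‖f‖_∞ + ‖Df‖_∞ + [Df]_r`. [folklore] -/
theorem eContDiffHolderNorm_one_eq_fderiv (f : E → F) :
    eContDiffHolderNorm 1 r f = eSupNorm f + eSupNorm (fderiv ℝ f) + eHolderNorm r (fderiv ℝ f) := by
  rw [eContDiffHolderNorm, Finset.sum_range_succ, Finset.sum_range_one, eSupNorm_iteratedFDeriv_zero,
    eSupNorm_iteratedFDeriv_one, eHolderNorm_iteratedFDeriv_one]

/-- **Membership in `C^{1,r}_b` from real bounds**: `f` `C¹`, `|f| ≤ M₀`, `|Df| ≤ M₁`, `Df`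
`r`-Hölder with constant `C`. [folklore] -/
theorem memContDiffHolder_one_of_bounds (hf : ContDiff ℝ 1 f) {M₀ M₁ : ℝ} (h0 : ∀ x, ‖f x‖ ≤ M₀)
    (h1 : ∀ x, ‖fderiv ℝ f x‖ ≤ M₁) {C : ℝ≥0} (hC : HolderWith C r (fderiv ℝ f)) :
    MemContDiffHolder 1 r f := by
  refine memContDiffHolder_one_iff.2 ⟨hf, (eSupNorm_le_ofReal h0).trans_lt ENNReal.ofReal_lt_top, ?_⟩
  exact memBoundedHolder_iff.2 ⟨⟨M₁, h1⟩, ⟨C, hC⟩⟩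

/-- **The `C^{1,r}` norm from real bounds**: under the hypotheses of
`memContDiffHolder_one_of_bounds`, `‖f‖_{C^{1,r}} ≤ M₀ + M₁ + C`. [folklore] -/
theorem eContDiffHolderNorm_one_le_of_bounds {M₀ M₁ : ℝ} (h0 : ∀ x, ‖f x‖ ≤ M₀)
    (h1 : ∀ x, ‖fderiv ℝ f x‖ ≤ M₁) {C : ℝ≥0} (hC : HolderWith C r (fderiv ℝ f)) :
    eContDiffHolderNorm 1 r f ≤ ENNReal.ofReal M₀ + ENNReal.ofReal M₁ + C := by
  rw [eContDiffHolderNorm_one_eq_fderiv]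
  exact add_le_add (add_le_add (eSupNorm_le_ofReal h0) (eSupNorm_le_ofReal h1)) hC.eHolderNorm_le

end Literature.Analysis.FunctionSpaces
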